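import Mathlib
import Literature.Computability.Complexity.Circuit
import Literature.Computability.Complexity.CircuitClasses
import Literature.Computability.Complexity.Classes
import Literature.Computability.Complexity.Space
import Literature.Computability.MetaComplexity.TruthTables
import Literature.Computability.MetaComplexity.TruthTablesProofs
import Literature.Computability.MetaComplexity.MCSP
import Literature.Computability.MetaComplexity.FormulaModelsAE
import Literature.Computability.MetaComplexity.BranchingPrograms
import Literature.Computability.MetaComplexity.LevinKt
import Literature.Computability.MetaComplexity.OliveiraSanthanam2018.ApproxMCSPFormulaMagnification
import Literature.Computability.MetaComplexity.ChenJinWilliams2020.ExplicitObstructions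
import Literature.Computability.MetaComplexity.ChenJinWilliams2019.ZeroErrorMagnification
import HarnessLib

/-!
# Chen–Jin–Williams 2019, Theorem 1.6: hardness magnification from `search-MCSP` and
# `search-MKtP` (D12: a fixed binary encoding of circuits; the fixed-length output convention of §5)

Citation header. L. Chen, C. Jin, R. R. Williams, *Hardness Magnification for all Sparse NP
Languages*, FOCS 2019 [bib: `ChenJinWilliams2019`]; full version ECCC TR19-118: Thm. 1.6 (p. 5),
Remark 1.7 (p. 5), §5 (p. 17 L22–28: the output convention; reminder of Thm. 1.6 L29–37).

Verbatim (p. 5): *"Theorem 1.6. Let C ∈ {⊕P, PP, PSPACE}, and m ≤ s(m) ≤ 2^{(1−Ω(1))m}. Let the input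
length n = 2^m. 1. If search-MCSP[s(m)] ∉ Circuit[n · poly(s(m))], then C ⊄ Circuit[poly(n)]. 2. If
search-MCSP[s(m)] ∉ U₂-Formula-⊕[n · poly(s(m))], then C ⊄ Formula[poly(n)]. 3. If search-MCSP[s(m)]
∉ B₂-Formula[n² · poly(s(m))], then C ⊄ Formula[poly(n)]. 4. If search-MCSP[s(m)] ∉ U₂-Formula[n³ ·
poly(s(m))], then C ⊄ Formula[poly(n)]. 5. If search-MCSP[s(m)] ∉ BP[n² · poly(s(m))], then C ⊄
BP[poly(n)]. 6. … 7. … Moreover, all above implications also hold for C = EXP, with search-MCSP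
replaced by search-MKtP."* (p. 17 L22–28): *"To work with circuits and formulas, we assume the output
is a fixed-length string for convenience. We assume the output for search-MCSP[s(m)] is always an
(L + 1)-length string where L = 100 s(m) log s(m), being either 0^{L+1} (for NO instance) or
1⟨C_padded⟩ where ⟨C_padded⟩ = ⟨C⟩10···0 is the (padded) description of a witness circuit. Similarly
we assume the output for search-MKtP[p(n)] is either 0^{L+1} or 1⟨M_padded⟩ where |⟨M_padded⟩| = L =
p(n) + 1."* (p. 3, Notation): circuits are fan-in two, size = gates; `U₂-Formula[s]` / `B₂-Formula[s]`
= formulas with at most `s` leaves over the De Morgan basis / over `B₂`; `BP[s]` = deterministic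
branching programs of size `s`.

What is typed (items 1, 3, 4, 5 for `C = PSPACE`, and item 1 for `C = EXP` with `search-MKtP`):

* **D12 — the description `⟨C⟩`.** `encodeCircuit m s C`: the gate list of `C : Circuit (Fin m)` in
  program order, each gate as `[arity (2 bits)] [truth table on the 4 assignments (4 bits)]
  [per argument: 1 tag bit (input / earlier gate) + ⌊log₂(m+s)⌋+1 index bits]`, followed by the
  output wire in the same format; `padDesc L d = (d ++ 1 0^L).take L` is print's `⟨C⟩10⋯0`, and
  `descLen s = 100·s·⌊log₂ s⌋` is print's `L`. PROVED: `length_encodeCircuit_lt` — for a `B₂`-circuit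
  of size `≤ s` on `m ≤ s` inputs, `s ≥ 2`, `|⟨C⟩| < L` (so the padding never truncates). The
  encoding is the standard one (bit `i` of `⟨C⟩` is read off the gate list in time polynomial in
  `|⟨C⟩|`); the typed facts below depend on it only through this convention, exactly as print
  depends on its unspecified "description of a witness circuit".
* **search-MCSP solved by a device class.** An input of length `n = 2^m` is `x : Fin (2^m) → Bool`,
  tabulating `tblFn x : (Fin m → Bool) → Bool` (`truthTable (tblFn x) = List.ofFn x`); a witness is a
  `B₂`-circuit of size `≤ s` computing it (`IsMCSPWitness`; `∃` a witness ↔ `List.ofFn x ∈ MCSP[s]`,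
  `exists_isMCSPWitness_iff`). A multi-output device of the class is rendered as a TUPLE of `L+1`
  single-output functions from a length-indexed function class `𝒞 (2^m)` (the classes of
  `ChenJinWilliams2020.circuitFns`: `b2CircuitFns`, `b2FormulaFns`, `deMorganFormulaFns`, `bpFns`) —
  a multi-output circuit of size `t` yields each output bit by a circuit of size `≤ t`, so the typed
  solver class CONTAINS print's, the typed non-membership hypothesis is STRONGER, and every typed
  implication is implied by the printed one. `SearchMCSPCorrect`: on a NO instance all `L+1` outputs
  are `0`; on a YES instance output `0` is `1` and outputs `1..L` spell `padDesc L ⟨C⟩` for SOME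
  witness `C` (print: "a witness circuit"; Remark 1.7's lexicographically first witness is a
  strengthening we do not impose).
* "`search-MCSP[s(m)] ∈ 𝒟[n^a · poly(s(m))]`" ≔ `∃ k, ∀ᶠ m, SearchMCSPSolvableAt (𝒟 (n ↦ n^a·s(m)^k
  + k)) s m` (a.e. in `m`; equivalent to the every-`m` reading up to the choice of `k`, since each
  single `m` is a finite problem). The facts take its NEGATION as hypothesis.
* `C = PSPACE` only: `⊕P` and `PP` have no decl in the tree; since `⊕P ∪ PP ⊆ PSPACE`, the conclusion
  "`PSPACE ⊄ 𝒟[poly]`" is the WEAKEST of the three printed ones, so each typed fact is implied by the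
  printed theorem. Items 2 (`U₂-Formula-⊕`), 6 (`AC_d[m*]`) and 7 (`TC_d`) are not typed here (no
  length-indexed FUNCTION classes for those models in the tree yet).
* **search-MKtP** (`C = EXP`, item 1): a witness for `x` at threshold `p` is a program `prog` with
  `U.run prog t = some x` and `|prog| + ⌈log₂ t⌉ ≤ p` (`IsKtWitness`; `∃` ↔ `Kt_U(x) ≤ p`,
  `exists_isKtWitness_iff`); the output is `0^{p+2}` or `1 · padDesc (p+1) prog` (print: `L = p(n)+1`).
  Parametrised by the reference machine `U : UniversalMachine` like every `Kt` statement of the tree.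

PROVED, besides the encoding lemmas: decision reduces to search (`sliceFn_mem_of_searchMCSPSolvableAt`:
output `0` of a search solver IS the indicator of `MCSP[s]` at length `2^m`, so decision hardness
against `𝒞` implies search hardness against `𝒞` — the easy direction of the folklore equivalence);
non-vacuity (`searchMCSPSolvableAt_univ`: the class of all functions solves search-MCSP, so
"`∉ 𝒞`" is a genuine restriction on `𝒞`); the analogous two facts for `search-MKtP`.
-/

namespace Literature.Computability.MetaComplexity.ChenJinWilliams2019

open Finset Filter _root_.Computability Literature.Computability.Complexity
open Literature.Computability.Complexity.Nondeterministic Literature.Computability.MetaComplexity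

/-! ### D12 — a fixed binary encoding of circuits (the description `⟨C⟩` of §5) -/

/-- `w` low-order bits of `k`, least significant first. [folklore] -/
def fixedWidth (w k : ℕ) : List Bool := List.ofFn fun i : Fin w => k.testBit i

/-- `fixedWidth` has the requested width. [folklore] -/
@[simp] theorem length_fixedWidth (w k : ℕ) : (fixedWidth w k).length = w := by
  simp [fixedWidth]

/-- A wire: tag bit (`0` = input variable, `1` = earlier gate) followed by `w` index bits. [folklore] -/
def encodeWire {m : ℕ} (w : ℕ) : Fin m ⊕ ℕ → List Bool
  | .inl i => false :: fixedWidth w i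
  | .inr j => true :: fixedWidth w j

/-- A wire costs `w + 1` bits. [folklore] -/
@[simp] theorem length_encodeWire {m : ℕ} (w : ℕ) (v : Fin m ⊕ ℕ) :
    (encodeWire w v).length = w + 1 := by
  cases v <;> simp [encodeWire]

/-- A gate: arity (2 bits), its truth table on the four assignments `a ↦ testBit t a`, `t < 4`
(4 bits — the full table of a gate of fan-in `≤ 2`), then its wires. [folklore] -/
def encodeGate {m : ℕ} (w : ℕ) (g : Gate (Fin m)) : List Bool :=
  fixedWidth 2 g.arity ++ List.ofFn (fun t : Fin 4 => g.op fun a => (t : ℕ).testBit a) ++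
    (List.ofFn fun a : Fin g.arity => encodeWire w (g.args a)).flatten

/-- A gate of arity `a` costs `6 + a(w+1)` bits. [folklore] -/
theorem length_encodeGate {m : ℕ} (w : ℕ) (g : Gate (Fin m)) :
    (encodeGate w g).length = 6 + g.arity * (w + 1) := by
  simp [encodeGate, List.length_flatten, Function.comp_def]
  ring

/-- Index width for a circuit with `≤ s` gates on `m` inputs: `⌊log₂(m+s)⌋ + 1` bits. [folklore] -/
def codeWidth (m s : ℕ) : ℕ := Nat.log 2 (m + s) + 1

/-- **`⟨C⟩`**: the gates of `C` in program order, then the output wire. [cite: ChenJinWilliams2019, §5 (p. 17 L22–28, "description of a witness circuit")] -/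
def encodeCircuit (m s : ℕ) (C : Circuit (Fin m)) : List Bool :=
  (C.gates.map (encodeGate (codeWidth m s))).flatten ++ encodeWire (codeWidth m s) C.output

/-- Print's `L = 100 · s · log s` (integer logarithm). [cite: ChenJinWilliams2019, §5 (p. 17 L25)] -/
def descLen (s : ℕ) : ℕ := 100 * s * Nat.log 2 s

/-- Print's `⟨C_padded⟩ = ⟨C⟩ 1 0⋯0`, cut to length exactly `L`. [cite: ChenJinWilliams2019, §5 (p. 17 L26)] -/
def padDesc (L : ℕ) (d : List Bool) : List Bool := (d ++ true :: List.replicate L false).take L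

/-- The padded description has length exactly `L`. [folklore] -/
@[simp] theorem length_padDesc (L : ℕ) (d : List Bool) : (padDesc L d).length = L := by
  simp [padDesc]
  omega

/-- The padding is faithful (a prefix of `padDesc L d` is `d ++ [1]`) as soon as `|d| < L`. [folklore] -/
theorem padDesc_take (L : ℕ) (d : List Bool) (h : d.length < L) :
    (padDesc L d).take (d.length + 1) = d ++ [true] := by
  rw [padDesc, List.take_take, min_eq_left (by omega), ← List.singleton_append,
    ← List.append_assoc, List.take_append_of_le_length (by simp), List.take_of_length_le (by simp)]

/-- **`|⟨C⟩| < L`** for a `B₂`-circuit with at most `s ≥ 2` gates on `m ≤ s` inputs: each gate costs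
`≤ 8 + 2w` bits and the output `w + 1`, with `w = ⌊log₂(m+s)⌋+1 ≤ ⌊log₂ s⌋ + 2`, so
`|⟨C⟩| ≤ s(12 + 2⌊log₂ s⌋) + ⌊log₂ s⌋ + 3 ≤ 18·s·⌊log₂ s⌋ < 100·s·⌊log₂ s⌋`. [folklore] -/
theorem length_encodeCircuit_lt {m s : ℕ} {C : Circuit (Fin m)} (hB : C.IsOver B2)
    (hs : C.size ≤ s) (hm : m ≤ s) (h2 : 2 ≤ s) : (encodeCircuit m s C).length < descLen s := by
  set w := codeWidth m s with hw
  have hgate : ∀ g ∈ C.gates, (encodeGate w g).length ≤ 8 + 2 * w := by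
    intro g hg
    have ha : g.arity ≤ 2 := hB g hg
    rw [length_encodeGate]
    nlinarith
  have hsum : ((C.gates.map (encodeGate w)).map List.length).sum ≤ C.gates.length * (8 + 2 * w) := by
    have h := List.sum_le_card_nsmul ((C.gates.map (encodeGate w)).map List.length) (8 + 2 * w)
      (by
        intro x hx
        simp only [List.map_map, List.mem_map, Function.comp_apply] at hx
        obtain ⟨g, hg, rfl⟩ := hx
        exact hgate g hg)
    simpa using h
  have hlen : (encodeCircuit m s C).length ≤ s * (8 + 2 * w) + (w + 1) := by
    rw [encodeCircuit, List.length_append, List.length_flatten, length_encodeWire]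
    have : C.gates.length ≤ s := hs
    nlinarith [hsum]
  -- `w ≤ ⌊log₂ s⌋ + 2`
  have hlog1 : 1 ≤ Nat.log 2 s := Nat.le_log_of_pow_le one_lt_two (by simpa using h2)
  have hwle : w ≤ Nat.log 2 s + 2 := by
    have h1 : Nat.log 2 (m + s) ≤ Nat.log 2 (2 * s) := Nat.log_mono_right (by omega)
    have h2' : Nat.log 2 (2 * s) = Nat.log 2 s + 1 := by
      rw [mul_comm, Nat.log_mul_base one_lt_two (by omega)]
    rw [hw, codeWidth]; omega
  rw [descLen]
  set ℓ := Nat.log 2 s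
  have hsl : 2 ≤ s * ℓ := by nlinarith
  calc (encodeCircuit m s C).length ≤ s * (8 + 2 * w) + (w + 1) := hlen
    _ ≤ s * (12 + 2 * ℓ) + (ℓ + 3) := by nlinarith
    _ < 100 * s * ℓ := by nlinarith

/-! ### `search-MCSP` solved by a class of devices -/

/-- The `m`-ary function tabulated by an input `x ∈ {0,1}^{2^m}` (in the tree's `boolFunEquivFin`
order, so that `truthTable (tblFn x) = List.ofFn x`). [folklore] -/
def tblFn {m : ℕ} (x : Fin (2 ^ m) → Bool) : (Fin m → Bool) → Bool := fun v => x (boolFunEquivFin m v)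

/-- The input string IS the truth table of the tabulated function. [folklore] -/
@[simp] theorem truthTable_tblFn {m : ℕ} (x : Fin (2 ^ m) → Bool) :
    truthTable (tblFn x) = List.ofFn x := by
  simp [truthTable, tblFn]

/-- A `search-MCSP[s]` witness for the input `x`: a `B₂`-circuit with at most `s` gates computing the
tabulated function. [cite: ChenJinWilliams2019, §5 (p. 17 L26, "a witness circuit")] -/
def IsMCSPWitness {m : ℕ} (s : ℕ) (x : Fin (2 ^ m) → Bool) (C : Circuit (Fin m)) : Prop :=
  C.IsOver B2 ∧ C.size ≤ s ∧ C.Computes (tblFn x)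

/-- A witness exists iff the tabulated function has `B₂`-circuit complexity `≤ s` (the infimum is
attained, `exists_computes_B2_size_eq_holds`). [folklore] -/
theorem exists_isMCSPWitness_iff_circuitSizeOver {m : ℕ} (s : ℕ) (x : Fin (2 ^ m) → Bool) :
    (∃ C, IsMCSPWitness s x C) ↔ circuitSizeOver B2 (tblFn x) ≤ s := by
  constructor
  · rintro ⟨C, hB, hs, hC⟩
    have hmem : C.size ∈ {k | ∃ C' : Circuit (Fin m), C'.IsOver B2 ∧ C'.Computes (tblFn x) ∧
        C'.size = k} := ⟨C, hB, hC, rfl⟩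
    exact (Nat.sInf_le hmem).trans hs
  · intro h
    obtain ⟨C, hB, hC, hsz⟩ := exists_computes_B2_size_eq_holds (tblFn x)
    exact ⟨C, hB, hsz ▸ h, hC⟩

/-- … iff the input, read as a string, lies in `MCSP[s]` (the tree's `MCSPSize`, at the arity-indexed
threshold `s`). [folklore] -/
theorem exists_isMCSPWitness_iff {m : ℕ} (s : ℕ → ℕ) (x : Fin (2 ^ m) → Bool) :
    (∃ C, IsMCSPWitness (s m) x C) ↔ List.ofFn x ∈ MCSPSize s := by
  rw [exists_isMCSPWitness_iff_circuitSizeOver]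
  constructor
  · intro h
    exact ⟨m, tblFn x, (truthTable_tblFn x).symm, h⟩
  · rintro ⟨n, f, hx, hf⟩
    have hlen : (List.ofFn x).length = 2 ^ n := by rw [hx, length_truthTable]
    rw [List.length_ofFn] at hlen
    have hnm : n = m := (Nat.pow_right_injective (le_refl 2) hlen).symm
    subst hnm
    have hfx : f = tblFn x := truthTable_injective (by rw [← hx, truthTable_tblFn])
    exact hfx ▸ hf

/-- **The output convention of §5 for `search-MCSP[s]`** on input `x` with output string
`y ∈ {0,1}^{L+1}`, `L = descLen s`: NO instance ⇒ `y = 0^{L+1}`; YES instance ⇒ `y = 1 ⟨C_padded⟩` for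
some witness `C`. [cite: ChenJinWilliams2019, §5 (p. 17 L22–28)] -/
def SearchMCSPCorrect {m : ℕ} (s : ℕ) (x : Fin (2 ^ m) → Bool) (y : Fin (descLen s + 1) → Bool) : Prop :=
  ((∀ C, ¬ IsMCSPWitness s x C) → ∀ i, y i = false) ∧
  ((∃ C, IsMCSPWitness s x C) → y 0 = true ∧ ∃ C, IsMCSPWitness s x C ∧
      ∀ j : Fin (descLen s), y j.succ = (padDesc (descLen s) (encodeCircuit m s C)).getD j false)

/-- **`search-MCSP[s]` is solved at parameter `m` (input length `n = 2^m`) by devices from the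
length-indexed function class `𝒞`**: some tuple of `L+1` output functions, each in `𝒞 (2^m)`, is
correct on every input. [cite: ChenJinWilliams2019, Thm. 1.6 + §5 (fixed-length output)] -/
def SearchMCSPSolvableAt (𝒞 : ∀ n : ℕ, Set ((Fin n → Bool) → Bool)) (s : ℕ → ℕ) (m : ℕ) : Prop :=
  ∃ out : Fin (descLen (s m) + 1) → ((Fin (2 ^ m) → Bool) → Bool),
    (∀ i, out i ∈ 𝒞 (2 ^ m)) ∧ ∀ x, SearchMCSPCorrect (s m) x (fun i => out i x)

/-- Output `0` of a correct solver is the indicator of `MCSP[s]`. [folklore] -/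
theorem searchMCSPCorrect_zero_iff {m : ℕ} {s : ℕ → ℕ} {x : Fin (2 ^ m) → Bool}
    {y : Fin (descLen (s m) + 1) → Bool} (h : SearchMCSPCorrect (s m) x y) :
    y 0 = true ↔ List.ofFn x ∈ MCSPSize s := by
  rw [← exists_isMCSPWitness_iff]
  constructor
  · intro h0
    by_contra hne
    push Not at hne
    have := h.1 hne 0
    rw [h0] at this
    exact Bool.noConfusion this
  · intro hex
    exact (h.2 hex).1

/-- **Decision reduces to search**: if `𝒞` solves `search-MCSP[s]` at `m`, then the `2^m`-slice of
`MCSP[s]` (`ChenJinWilliams2020.sliceFn`) is in `𝒞 (2^m)` — it is output `0`. Hence decision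
hardness against `𝒞` implies search hardness against `𝒞`. [folklore] -/
theorem sliceFn_mem_of_searchMCSPSolvableAt {𝒞 : ∀ n : ℕ, Set ((Fin n → Bool) → Bool)}
    {s : ℕ → ℕ} {m : ℕ} (h : SearchMCSPSolvableAt 𝒞 s m) :
    ChenJinWilliams2020.sliceFn (MCSPSize s) (2 ^ m) ∈ 𝒞 (2 ^ m) := by
  obtain ⟨out, hout, hcorr⟩ := h
  have heq : ChenJinWilliams2020.sliceFn (MCSPSize s) (2 ^ m) = out 0 := by
    funext x
    have h0 := searchMCSPCorrect_zero_iff (hcorr x)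
    simp only [ChenJinWilliams2020.sliceFn, Set.boolIndicator]
    rw [Bool.eq_iff_iff, h0]
    simp only [ite_eq_left_iff, Bool.false_eq_true, imp_false, not_not]
    exact Iff.rfl
  rw [heq]; exact hout 0

/-- Contrapositive packaging: decision hardness at `m` gives search hardness at `m`. [folklore] -/
theorem not_searchMCSPSolvableAt_of_sliceFn_not_mem {𝒞 : ∀ n : ℕ, Set ((Fin n → Bool) → Bool)}
    {s : ℕ → ℕ} {m : ℕ} (h : ChenJinWilliams2020.sliceFn (MCSPSize s) (2 ^ m) ∉ 𝒞 (2 ^ m)) :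
    ¬ SearchMCSPSolvableAt 𝒞 s m :=
  fun hS => h (sliceFn_mem_of_searchMCSPSolvableAt hS)

/-- **Non-vacuity**: the class of ALL functions solves `search-MCSP[s]` at every `m` (pick, per YES
input, any witness and spell its padded description). [folklore] -/
theorem searchMCSPSolvableAt_univ (s : ℕ → ℕ) (m : ℕ) :
    SearchMCSPSolvableAt (fun _ => Set.univ) s m := by
  classical
  let wit : (Fin (2 ^ m) → Bool) → Option (Circuit (Fin m)) := fun x =>
    if h : ∃ C, IsMCSPWitness (s m) x C then some h.choose else none
  refine ⟨fun i x => match wit x with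
      | none => false
      | some C => if i = 0 then true
          else (padDesc (descLen (s m)) (encodeCircuit m (s m) C)).getD (i.val - 1) false,
    fun _ => Set.mem_univ _, fun x => ⟨fun hno i => ?_, fun hyes => ?_⟩⟩
  · have hw : wit x = none := by
      simp only [wit, dif_neg (not_exists.2 hno)]
    simp [hw]
  · have hw : wit x = some hyes.choose := by simp only [wit, dif_pos hyes]
    refine ⟨by simp [hw], hyes.choose, hyes.choose_spec, fun j => ?_⟩
    simp [hw, Fin.succ_ne_zero]

/-- The parameter regime of Thm. 1.6: `m ≤ s(m) ≤ 2^{(1−Ω(1))m}`. [cite: ChenJinWilliams2019, Thm. 1.6 (hypothesis on s)] -/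
def SizeRegime (s : ℕ → ℕ) : Prop :=
  (∀ m, m ≤ s m) ∧ ∃ c : ℝ, c < 1 ∧ ∀ᶠ m : ℕ in atTop, (s m : ℝ) ≤ (2 : ℝ) ^ (c * m)

/-- `PSPACE ⊄ Formula[poly]`: some `PSPACE` language has no polynomial-size De Morgan formulas (a.e.
leaf-size classes `FORMULAae`, as in `OliveiraSanthanam2018.NPNotInFormulaPoly`). [folklore] -/
def PSPACENotInFormulaPoly : Prop := ∃ L ∈ PSPACE, ∀ c : ℕ, L ∉ FORMULAae fun n => n ^ c

/-- `PSPACE ⊄ BP[poly]`: some `PSPACE` language has no polynomial-size branching programs (a.e. size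
classes `BPSIZEae`). [folklore] -/
def PSPACENotInBPPoly : Prop := ∃ L ∈ PSPACE, ∀ c : ℕ, L ∉ BPSIZEae fun n => n ^ c

/-- **Thm. 1.6 item 1, `C = PSPACE`**: if `search-MCSP[s(m)]` is not solved (a.e. in `m`) by
`B₂`-circuits of size `n · s(m)^k + k` for any `k`, then `PSPACE ⊄ P/poly`. OPEN — a named `Prop`.
[cite: ChenJinWilliams2019, Thm. 1.6 item 1 (C = PSPACE)] -/
def thm16_item1 : Prop :=
  ∀ s : ℕ → ℕ, SizeRegime s →
    (¬ ∃ k : ℕ, ∀ᶠ m : ℕ in atTop,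
        SearchMCSPSolvableAt (b2CircuitFns fun n => n * s m ^ k + k) s m) →
    ¬ (PSPACE ⊆ PPoly)

/-- **Thm. 1.6 item 3, `C = PSPACE`**: `search-MCSP[s(m)] ∉ B₂-Formula[n² · poly(s(m))]` ⇒
`PSPACE ⊄ Formula[poly]`. [cite: ChenJinWilliams2019, Thm. 1.6 item 3 (C = PSPACE)] -/
def thm16_item3 : Prop :=
  ∀ s : ℕ → ℕ, SizeRegime s →
    (¬ ∃ k : ℕ, ∀ᶠ m : ℕ in atTop,
        SearchMCSPSolvableAt (ChenJinWilliams2020.b2FormulaFns fun n => n ^ 2 * s m ^ k + k) s m) →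
    PSPACENotInFormulaPoly

/-- **Thm. 1.6 item 4, `C = PSPACE`**: `search-MCSP[s(m)] ∉ U₂-Formula[n³ · poly(s(m))]` ⇒
`PSPACE ⊄ Formula[poly]`. [cite: ChenJinWilliams2019, Thm. 1.6 item 4 (C = PSPACE)] -/
def thm16_item4 : Prop :=
  ∀ s : ℕ → ℕ, SizeRegime s →
    (¬ ∃ k : ℕ, ∀ᶠ m : ℕ in atTop,
        SearchMCSPSolvableAt (ChenJinWilliams2020.deMorganFormulaFns fun n => n ^ 3 * s m ^ k + k)
          s m) →
    PSPACENotInFormulaPoly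

/-- **Thm. 1.6 item 5, `C = PSPACE`**: `search-MCSP[s(m)] ∉ BP[n² · poly(s(m))]` ⇒ `PSPACE ⊄ BP[poly]`.
[cite: ChenJinWilliams2019, Thm. 1.6 item 5 (C = PSPACE)] -/
def thm16_item5 : Prop :=
  ∀ s : ℕ → ℕ, SizeRegime s →
    (¬ ∃ k : ℕ, ∀ᶠ m : ℕ in atTop,
        SearchMCSPSolvableAt (ChenJinWilliams2020.bpFns fun n => n ^ 2 * s m ^ k + k) s m) →
    PSPACENotInBPPoly

/-- The search hypothesis class shrinks with `k`: solvability by size `n·s^k + k` devices is monotone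
in `k` (for classes monotone in their size bound). [folklore] -/
theorem SearchMCSPSolvableAt.mono {𝒞 𝒞' : ∀ n : ℕ, Set ((Fin n → Bool) → Bool)}
    (h𝒞 : ∀ n, 𝒞 n ⊆ 𝒞' n) {s : ℕ → ℕ} {m : ℕ} (h : SearchMCSPSolvableAt 𝒞 s m) :
    SearchMCSPSolvableAt 𝒞' s m := by
  obtain ⟨out, hout, hcorr⟩ := h
  exact ⟨out, fun i => h𝒞 _ (hout i), hcorr⟩

/-! ### `search-MKtP` (Thm. 1.6, "Moreover", `C = EXP`) -/

section MKtP

variable (U : UniversalMachine)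

/-- A `search-MKtP[p]` witness for `x`: a program printing `x` on `U` within a time budget `t` with
`|prog| + ⌈log₂ t⌉ ≤ p`. [cite: ChenJinWilliams2019, §5 (p. 17 L27–28, "1⟨M_padded⟩")] -/
def IsKtWitness (p : ℕ) (x prog : List Bool) : Prop :=
  ∃ t : ℕ, U.run prog t = some x ∧ prog.length + Nat.clog 2 t ≤ p

/-- A witness exists iff `Kt_U(x) ≤ p`. [folklore] -/
theorem exists_isKtWitness_iff {p : ℕ} {x : List Bool} :
    (∃ prog, IsKtWitness U p x prog) ↔ U.levinKt x ≤ p := by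
  rw [UniversalMachine.levinKt_le_coe_iff]
  exact ⟨fun ⟨prog, t, h1, h2⟩ => ⟨prog, t, h1, h2⟩, fun ⟨prog, t, h1, h2⟩ => ⟨prog, t, h1, h2⟩⟩

/-- … iff `x ∈ MKtP[p]` (at the length-indexed threshold). [folklore] -/
theorem exists_isKtWitness_iff_mem {p : ℕ → ℕ} {x : List Bool} :
    (∃ prog, IsKtWitness U (p x.length) x prog) ↔ x ∈ U.MKtP p :=
  exists_isKtWitness_iff U

/-- A witness is shorter than the output block: `|prog| ≤ p < p + 1`. [folklore] -/
theorem IsKtWitness.length_lt {p : ℕ} {x prog : List Bool} (h : IsKtWitness U p x prog) :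
    prog.length < p + 1 := by
  obtain ⟨t, -, ht⟩ := h
  omega

/-- **The output convention of §5 for `search-MKtP[p]`**: `0^{p+2}` on a NO instance, `1⟨M_padded⟩`
with `|⟨M_padded⟩| = p + 1` on a YES instance, `M` some witness program. [cite: ChenJinWilliams2019, §5 (p. 17 L27–28)] -/
def SearchMKtPCorrect (p : ℕ) {n : ℕ} (x : Fin n → Bool) (y : Fin (p + 2) → Bool) : Prop :=
  ((∀ prog, ¬ IsKtWitness U p (List.ofFn x) prog) → ∀ i, y i = false) ∧
  ((∃ prog, IsKtWitness U p (List.ofFn x) prog) → y 0 = true ∧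
    ∃ prog, IsKtWitness U p (List.ofFn x) prog ∧
      ∀ j : Fin (p + 1), y j.succ = (padDesc (p + 1) prog).getD j false)

/-- **`search-MKtP[p]` is solved at length `n` by devices from `𝒞`.** [cite: ChenJinWilliams2019, Thm. 1.6 ("Moreover") + §5] -/
def SearchMKtPSolvableAt (𝒞 : ∀ n : ℕ, Set ((Fin n → Bool) → Bool)) (p : ℕ → ℕ) (n : ℕ) : Prop :=
  ∃ out : Fin (p n + 2) → ((Fin n → Bool) → Bool),
    (∀ i, out i ∈ 𝒞 n) ∧ ∀ x, SearchMKtPCorrect U (p n) x (fun i => out i x)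

/-- Decision reduces to search for `MKtP`: output `0` is the `n`-slice of `MKtP[p]`. [folklore] -/
theorem sliceFn_MKtP_mem_of_searchMKtPSolvableAt {𝒞 : ∀ n : ℕ, Set ((Fin n → Bool) → Bool)}
    {p : ℕ → ℕ} {n : ℕ} (h : SearchMKtPSolvableAt U 𝒞 p n) :
    ChenJinWilliams2020.sliceFn (U.MKtP p) n ∈ 𝒞 n := by
  obtain ⟨out, hout, hcorr⟩ := h
  have heq : ChenJinWilliams2020.sliceFn (U.MKtP p) n = out 0 := by
    funext x
    have hc := hcorr x
    have hlen : (List.ofFn x).length = n := List.length_ofFn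
    have key : out 0 x = true ↔ List.ofFn x ∈ U.MKtP p := by
      rw [← exists_isKtWitness_iff_mem, hlen]
      constructor
      · intro h0
        by_contra hne
        push Not at hne
        have := hc.1 hne 0
        simp only at this
        rw [h0] at this
        exact Bool.noConfusion this
      · intro hex; exact (hc.2 hex).1
    simp only [ChenJinWilliams2020.sliceFn, Set.boolIndicator]
    rw [Bool.eq_iff_iff, key]
    simp only [ite_eq_left_iff, Bool.false_eq_true, imp_false, not_not]
    exact Iff.rfl
  rw [heq]; exact hout 0

/-- Non-vacuity for `search-MKtP`: all functions solve it. [folklore] -/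
theorem searchMKtPSolvableAt_univ (p : ℕ → ℕ) (n : ℕ) :
    SearchMKtPSolvableAt U (fun _ => Set.univ) p n := by
  classical
  let wit : (Fin n → Bool) → Option (List Bool) := fun x =>
    if h : ∃ prog, IsKtWitness U (p n) (List.ofFn x) prog then some h.choose else none
  refine ⟨fun i x => match wit x with
      | none => false
      | some prog => if i = 0 then true else (padDesc (p n + 1) prog).getD (i.val - 1) false,
    fun _ => Set.mem_univ _, fun x => ⟨fun hno i => ?_, fun hyes => ?_⟩⟩
  · have hw : wit x = none := by simp only [wit, dif_neg (not_exists.2 hno)]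
    simp [hw]
  · have hw : wit x = some hyes.choose := by simp only [wit, dif_pos hyes]
    refine ⟨by simp [hw], hyes.choose, hyes.choose_spec, fun j => ?_⟩
    simp [hw, Fin.succ_ne_zero]

/-- The `MKtP` parameter regime of Thm. 1.6 / 1.8: `log n ≤ p(n) ≤ n^{1−Ω(1)}`. [cite: ChenJinWilliams2019, Thm. 1.8 (hypothesis on p)] -/
def KtRegime (p : ℕ → ℕ) : Prop :=
  (∀ n, Nat.clog 2 n ≤ p n) ∧ ∃ c : ℝ, c < 1 ∧ ∀ᶠ n : ℕ in atTop, (p n : ℝ) ≤ (n : ℝ) ^ c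

/-- **Thm. 1.6 item 1 for `search-MKtP`, `C = EXP`**: if `search-MKtP[p(n)]` is not solved (a.e.) by
`B₂`-circuits of size `n · p(n)^k + k` for any `k`, then `EXP ⊄ P/poly`. OPEN — a named `Prop`,
for the reference machine `U`. [cite: ChenJinWilliams2019, Thm. 1.6 item 1 ("Moreover", C = EXP)] -/
def thm16_MKtP_item1 : Prop :=
  ∀ p : ℕ → ℕ, KtRegime p →
    (¬ ∃ k : ℕ, ∀ᶠ n : ℕ in atTop,
        SearchMKtPSolvableAt U (b2CircuitFns fun n' => n' * p n ^ k + k) p n) →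
    ¬ (EXP ⊆ PPoly)

end MKtP

end Literature.Computability.MetaComplexity.ChenJinWilliams2019
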